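import Mathlib
import Literature.AlgebraicGeometry.Motives.FrobeniusMorphism

/-!
# `PAlteration.PicoverToRadicialBottom` (stmt-ResolutionOfSingularities-0556), line
`theta-finite-cofinite-roots`: regularity of `k(θ) ⊗ₖ A` from its finite stages

Route `ResolutionOfSingularities/pAlteration`, crux `PicoverToRadicialBottom`; helper file
(`--supports`) feeding the lead's stub `stub_cofiniteRegularTwistGlue`. For a field `k` of
characteristic `p`, elements `θ_i` of an extension `E` with `θ_i^{p^r} ∈ k`, and a `k`-algebra
`A`: if `k(θ_i : i ∈ S) ⊗ₖ A` is a regular ring for every finite `S` and `L ⊗ₖ A` is Noetherian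
for `L := k(θ_i : i)`, then `L ⊗ₖ A` is regular (`isRegularRing_tensor_unionField`): every local
ring of `L ⊗ₖ A` is exhausted by the local rings of the stages through injective, local, integral
maps — abstractly, for injective `j_i : B_i → C` with `C^{q} ⊆ j_i(B_i)` ("Frobenius-dominated
stages", `stub_unionRegularOfStages`, a registered stub of the line). The directed-union lemma for regular local rings
(`stub_directedUnionRegular`, landed separately) is taken as a hypothesis.
-/

noncomputable section

-- single-problem summit: the doubled namespace component `ResolutionOfSingularities` is forced
set_option linter.dupNamespace false

open scoped TensorProduct
open IntermediateField

namespace Summit.ResolutionOfSingularities.ResolutionOfSingularities.Theorems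

section RingGlue

variable (k : Type) [Field k] {E : Type} [Field E] [Algebra k E] {G : Type} (θ : G → E)
  (A : Type) [CommRing A] [Algebra k A]

/-- `k(θ_S) ≤ k(θ)`. [folklore] -/
theorem stageField_le (S : Finset G) : IntermediateField.adjoin k (θ '' ((S : Finset G) : Set G)) ≤ IntermediateField.adjoin k (Set.range θ) :=
  adjoin.mono _ _ _ (Set.image_subset_range _ _)

/-- `k(θ_S) ≤ k(θ_T)` for `S ⊆ T`. [folklore] -/
theorem stageField_mono {S T : Finset G} (h : S ⊆ T) : IntermediateField.adjoin k (θ '' ((S : Finset G) : Set G)) ≤ IntermediateField.adjoin k (θ '' ((T : Finset G) : Set G)) :=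
  adjoin.mono _ _ _ (Set.image_mono (Finset.coe_subset.mpr h))

/-- Every element of `k(θ)` lies in some finite stage `k(θ_S)`. [folklore] -/
theorem exists_stage_of_mem_unionField {x : E} (hx : x ∈ IntermediateField.adjoin k (Set.range θ)) :
    ∃ S : Finset G, x ∈ IntermediateField.adjoin k (θ '' ((S : Finset G) : Set G)) := by
  classical
  obtain ⟨T, hT, hxT⟩ := exists_finset_of_mem_adjoin hx
  choose g hg using fun (e : T) => hT e.2
  refine ⟨Finset.univ.image g, adjoin.mono _ _ _ ?_ hxT⟩
  intro e he
  refine ⟨g ⟨e, he⟩, ?_, hg ⟨e, he⟩⟩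
  simp

/-- `j_S` is injective (`A` is flat over the field `k`). [folklore] -/
theorem stageMap_injective (S : Finset G) : Function.Injective ((Algebra.TensorProduct.map (IntermediateField.inclusion (stageField_le k θ S)) (AlgHom.id k A))) := by
  have h := Module.Flat.rTensor_preserves_injective_linearMap (M := A)
    (inclusion (stageField_le k θ S)).toLinearMap
    (by exact inclusion_injective (stageField_le k θ S))
  intro x y hxy
  exact h hxy

/-- `j_S` factors `j_T` for `S ⊆ T`. [folklore] -/
theorem stageMap_comp_map {S T : Finset G} (h : S ⊆ T) (x : ↥(IntermediateField.adjoin k (θ '' ((S : Finset G) : Set G))) ⊗[k] A) :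
    (Algebra.TensorProduct.map (IntermediateField.inclusion (stageField_le k θ T)) (AlgHom.id k A)) (Algebra.TensorProduct.map (inclusion (stageField_mono k θ h)) (AlgHom.id k A) x) =
      (Algebra.TensorProduct.map (IntermediateField.inclusion (stageField_le k θ S)) (AlgHom.id k A)) x := by
  induction x using TensorProduct.induction_on with
  | zero => simp
  | tmul a b => rfl
  | add x y hx hy => rw [map_add, map_add, hx, hy, map_add]

/-- The range of `j_S` grows with `S`. [folklore] -/
theorem range_stageMap_mono {S T : Finset G} (h : S ⊆ T) :
    Set.range ((Algebra.TensorProduct.map (IntermediateField.inclusion (stageField_le k θ S)) (AlgHom.id k A))) ⊆ Set.range ((Algebra.TensorProduct.map (IntermediateField.inclusion (stageField_le k θ T)) (AlgHom.id k A))) := by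
  rintro _ ⟨x, rfl⟩
  exact ⟨_, stageMap_comp_map k θ A h x⟩

/-- Every element of `k(θ) ⊗ A` comes from a finite stage. [folklore] -/
theorem exists_stage_mem_range (z : ↥(IntermediateField.adjoin k (Set.range θ)) ⊗[k] A) :
    ∃ S : Finset G, z ∈ Set.range ((Algebra.TensorProduct.map (IntermediateField.inclusion (stageField_le k θ S)) (AlgHom.id k A))) := by
  classical
  induction z using TensorProduct.induction_on with
  | zero => exact ⟨∅, 0, map_zero _⟩
  | tmul a b =>
    obtain ⟨S, hS⟩ := exists_stage_of_mem_unionField k θ a.2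
    exact ⟨S, ⟨a.1, hS⟩ ⊗ₜ b, rfl⟩
  | add x y hx hy =>
    obtain ⟨S, hS⟩ := hx
    obtain ⟨T, hT⟩ := hy
    refine ⟨S ∪ T, ?_⟩
    obtain ⟨x', hx'⟩ := range_stageMap_mono k θ A (Finset.subset_union_left (s₂ := T)) hS
    obtain ⟨y', hy'⟩ := range_stageMap_mono k θ A (Finset.subset_union_right (s₁ := S)) hT
    exact ⟨x' + y', by rw [map_add, hx', hy']⟩

variable (p : ℕ) [Fact p.Prime] [CharP k p] (r : ℕ)
  (hθ : ∀ i, ∃ y : k, algebraMap k E y = θ i ^ p ^ r)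

include hθ in
/-- Every element of `k(θ)` has its `p^r`-th power in `k`. [folklore] -/
theorem exists_algebraMap_eq_pow_of_mem_unionField {x : E} (hx : x ∈ IntermediateField.adjoin k (Set.range θ)) :
    ∃ y : k, algebraMap k E y = x ^ p ^ r := by
  haveI : CharP E p := charP_of_injective_algebraMap (algebraMap k E).injective p
  let M : IntermediateField k E :=
    { carrier := {x | ∃ y : k, algebraMap k E y = x ^ p ^ r}
      mul_mem' := by
        rintro a b ⟨ya, ha⟩ ⟨yb, hb⟩
        exact ⟨ya * yb, by rw [map_mul, ha, hb, mul_pow]⟩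
      one_mem' := ⟨1, by simp⟩
      add_mem' := by
        rintro a b ⟨ya, ha⟩ ⟨yb, hb⟩
        exact ⟨ya + yb, by rw [map_add, ha, hb, add_pow_char_pow]⟩
      zero_mem' := ⟨0, by simp [zero_pow (pow_ne_zero r (Fact.out : p.Prime).ne_zero)]⟩
      algebraMap_mem' := fun y => ⟨y ^ p ^ r, by rw [map_pow]⟩
      inv_mem' := by
        rintro a ⟨ya, ha⟩
        exact ⟨ya⁻¹, by rw [map_inv₀, ha, inv_pow]⟩ }
  have hle : IntermediateField.adjoin k (Set.range θ) ≤ M := by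
    refine adjoin_le_iff.mpr ?_
    rintro _ ⟨i, rfl⟩
    exact hθ i
  exact hle hx

omit [Fact p.Prime] in
/-- `p = 0` in `k(θ) ⊗ A`. [folklore] -/
theorem natCast_eq_zero_tensor : (p : ↥(IntermediateField.adjoin k (Set.range θ)) ⊗[k] A) = 0 := by
  rw [← map_natCast (algebraMap k (↥(IntermediateField.adjoin k (Set.range θ)) ⊗[k] A)) p, CharP.cast_eq_zero, map_zero]

include hθ in
/-- **Frobenius lands in every stage**: for `t ∈ k(θ) ⊗ A` and any finite `S`, `t^{p^r} = j_S(t_S)`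
for some `t_S`. [folklore] -/
theorem exists_stageMap_eq_pow (S : Finset G) (t : ↥(IntermediateField.adjoin k (Set.range θ)) ⊗[k] A) :
    ∃ tS : ↥(IntermediateField.adjoin k (θ '' ((S : Finset G) : Set G))) ⊗[k] A, (Algebra.TensorProduct.map (IntermediateField.inclusion (stageField_le k θ S)) (AlgHom.id k A)) tS = t ^ p ^ r := by
  induction t using TensorProduct.induction_on with
  | zero =>
    exact ⟨0, by rw [map_zero]; exact (zero_pow (M₀ := ↥(IntermediateField.adjoin k (Set.range θ)) ⊗[k] A)
      (pow_ne_zero r (Fact.out : p.Prime).ne_zero)).symm⟩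
  | tmul a b =>
    obtain ⟨y, hy⟩ := exists_algebraMap_eq_pow_of_mem_unionField k θ p r hθ a.2
    refine ⟨algebraMap k _ y ⊗ₜ (b ^ p ^ r), ?_⟩
    rw [Algebra.TensorProduct.tmul_pow]
    change (inclusion (stageField_le k θ S)) (algebraMap k _ y) ⊗ₜ[k] (AlgHom.id k A) (b ^ p ^ r) = _
    rw [AlgHom.commutes, AlgHom.id_apply]
    congr 1
    apply Subtype.ext
    change algebraMap k E y = (a : E) ^ p ^ r
    exact hy
  | add x y hx hy =>
    obtain ⟨xS, hxS⟩ := hx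
    obtain ⟨yS, hyS⟩ := hy
    refine ⟨xS + yS, ?_⟩
    rw [map_add, hxS, hyS]
    exact (Literature.AlgebraicGeometry.Motives.add_pow_prime_pow_of_natCast_eq_zero
      (A := ↥(IntermediateField.adjoin k (Set.range θ)) ⊗[k] A) p (natCast_eq_zero_tensor k θ A p) r x y).symm

end RingGlue

/-! ### The local maps at a prime, abstractly

For an injective ring homomorphism `j : B → C` such that every `t ∈ C` has `t^q = j(t_B)` for some
`t_B` (`q ≥ 1`), and a prime `𝔓 ⊆ C`, the induced local homomorphism `B_{j⁻¹𝔓} → C_𝔓` is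
injective and integral, and an element `j(b)/j(t)` lies in its image. -/

section LocalMaps

variable {B C : Type} [CommRing B] [CommRing C] (j : B →+* C) (q : ℕ) (hq : 0 < q)
  (hj : Function.Injective j) (hfrob : ∀ t : C, ∃ tB : B, j tB = t ^ q)
  (𝔓 : Ideal C) [𝔓.IsPrime]

include hfrob in
/-- A witness outside `𝔓` has its `q`-th power coming from outside `j⁻¹ 𝔓`. [folklore] -/
theorem exists_pow_witness (t : C) (ht : t ∉ 𝔓) :
    ∃ tB : B, tB ∉ 𝔓.comap j ∧ j tB = t ^ q := by
  obtain ⟨tB, htB⟩ := hfrob t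
  refine ⟨tB, fun hmem => ht ?_, htB⟩
  have : t ^ q ∈ 𝔓 := by rw [← htB]; exact hmem
  exact ‹𝔓.IsPrime›.mem_of_pow_mem _ this

include hq hj hfrob in
/-- The local map `B_{j⁻¹𝔓} → C_𝔓` is injective. [folklore] -/
theorem localRingHom_injective_of_frobenius :
    Function.Injective (Localization.localRingHom (𝔓.comap j) 𝔓 j rfl) := by
  refine (injective_iff_map_eq_zero _).mpr fun z hz => ?_
  obtain ⟨⟨a, s⟩, rfl⟩ := IsLocalization.mk'_surjective (𝔓.comap j).primeCompl z
  rw [Localization.localRingHom_mk', IsLocalization.mk'_eq_zero_iff] at hz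
  obtain ⟨⟨t, ht⟩, hta⟩ := hz
  obtain ⟨tB, htB, htBe⟩ := exists_pow_witness j q hfrob 𝔓 t ht
  rw [IsLocalization.mk'_eq_zero_iff]
  refine ⟨⟨tB, htB⟩, hj ?_⟩
  change j (tB * a) = j 0
  rw [map_mul, map_zero, htBe]
  have hr : q = (q - 1) + 1 := (Nat.sub_add_cancel hq).symm
  change t ^ q * j a = 0
  rw [hr, pow_succ, mul_assoc]
  change t ^ (q - 1) * (t * j a) = 0
  rw [hta, mul_zero]

include hq hfrob in
/-- The local map `B_{j⁻¹𝔓} → C_𝔓` is integral. [folklore] -/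
theorem localRingHom_isIntegral_of_frobenius :
    (Localization.localRingHom (𝔓.comap j) 𝔓 j rfl).IsIntegral := by
  set φ := Localization.localRingHom (𝔓.comap j) 𝔓 j rfl with hφ
  intro y
  obtain ⟨⟨b, ⟨t, ht⟩⟩, hy⟩ := IsLocalization.mk'_surjective 𝔓.primeCompl y
  rw [← hy]
  dsimp only
  obtain ⟨tB, htB, htBe⟩ := exists_pow_witness j q hfrob 𝔓 t ht
  have hr : q = (q - 1) + 1 := (Nat.sub_add_cancel hq).symm
  have htpow : t ^ q ∈ 𝔓.primeCompl := fun h => ht (‹𝔓.IsPrime›.mem_of_pow_mem _ h)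
  -- `b / t = (b t^{q - 1}) · (1 / t^q)`
  have hsplit : IsLocalization.mk' (Localization.AtPrime 𝔓) b (⟨t, ht⟩ : 𝔓.primeCompl) =
      algebraMap C (Localization.AtPrime 𝔓) (b * t ^ (q - 1)) *
        IsLocalization.mk' (Localization.AtPrime 𝔓) 1 (⟨t ^ q, htpow⟩ : 𝔓.primeCompl) := by
    rw [← IsLocalization.mk'_eq_mul_mk'_one]
    refine IsLocalization.mk'_eq_of_eq ?_
    change t * (b * t ^ (q - 1)) = t ^ q * b
    conv_rhs => rw [hr, pow_succ]
    ring
  rw [hsplit]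
  refine RingHom.IsIntegralElem.mul _ ?_ ?_
  · -- the numerator is integral over `B`
    obtain ⟨bB, hbB⟩ := hfrob (b * t ^ (q - 1))
    refine ⟨Polynomial.X ^ q - Polynomial.C (algebraMap B _ bB),
      Polynomial.monic_X_pow_sub_C _ hq.ne', ?_⟩
    rw [Polynomial.eval₂_sub, Polynomial.eval₂_X_pow, Polynomial.eval₂_C, hφ,
      Localization.localRingHom_to_map, ← map_pow, hbB, sub_self]
  · -- `1 / t^q` is in the image
    have himg : φ (IsLocalization.mk' _ 1 (⟨tB, htB⟩ : (𝔓.comap j).primeCompl)) =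
        IsLocalization.mk' (Localization.AtPrime 𝔓) 1 (⟨t ^ q, htpow⟩ : 𝔓.primeCompl) := by
      rw [hφ, Localization.localRingHom_mk', map_one]
      congr 1
      exact Subtype.ext htBe
    rw [← himg]
    exact RingHom.isIntegralElem_map _

/-- An element `j(b) / j(t)` of `C_𝔓` is the image of `b / t`. [folklore] -/
theorem mk'_mem_range_localRingHom (b t : B) (ht : j t ∉ 𝔓) :
    IsLocalization.mk' (Localization.AtPrime 𝔓) (j b) (⟨j t, ht⟩ : 𝔓.primeCompl) ∈
      Set.range (Localization.localRingHom (𝔓.comap j) 𝔓 j rfl) :=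
  ⟨IsLocalization.mk' _ b (⟨t, ht⟩ : (𝔓.comap j).primeCompl), by
    rw [Localization.localRingHom_mk']⟩

end LocalMaps

section AbstractMain

/-- **From Frobenius-dominated regular stages to the whole ring** (registered stub
`stub_unionRegularOfStages` of the line skeleton). Let `C` be a Noetherian ring and
`j_i : B_i → C` injective ring homomorphisms from regular rings such that every `t ∈ C` has
`t^q = j_i(t_i)` for each `i` (`q ≥ 1`) and every finite subset of `C` lies in the image of some
`j_i`. If the directed-union lemma for regular local rings holds (first hypothesis; it is
`stub_directedUnionRegular`), then `C` is a regular ring (apply it at every prime to the local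
maps `(B_i)_{j_i⁻¹𝔓} → C_𝔓`). [folklore] -/
theorem stub_unionRegularOfStages :
    ∀ (_ : ∀ (O : Type) [CommRing O] [IsLocalRing O] [IsNoetherianRing O] (ι : Type) (Oi : ι → Type)
      [∀ i, CommRing (Oi i)] [∀ i, IsLocalRing (Oi i)] (φ : ∀ i, Oi i →+* O),
      (∀ i, IsLocalHom (φ i)) → (∀ i, Function.Injective (φ i)) → (∀ i, (φ i).IsIntegral) →
      (∀ i, IsRegularLocalRing (Oi i)) →
      (∀ s : Finset O, ∃ i, (s : Set O) ⊆ Set.range (φ i)) → IsRegularLocalRing O)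
    (C : Type) [CommRing C] [IsNoetherianRing C] (ι : Type) (B : ι → Type) [∀ i, CommRing (B i)]
    (j : ∀ i, B i →+* C) (q : ℕ), 0 < q → (∀ i, Function.Injective (j i)) →
    (∀ i (t : C), ∃ tB : B i, j i tB = t ^ q) → (∀ i, IsRegularRing (B i)) →
    (∀ s : Finset C, ∃ i, (s : Set C) ⊆ Set.range (j i)) → IsRegularRing C := by
  intro hT5 C _ _ ι B _ j q hq hj hfrob hreg hcov
  classical
  refine isRegularRing_iff.mpr fun 𝔓 h𝔓 => ?_
  haveI : ∀ i, (Ideal.comap (j i) 𝔓).IsPrime := fun i => Ideal.comap_isPrime _ _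
  refine hT5 (Localization.AtPrime 𝔓) ι (fun i => Localization.AtPrime (Ideal.comap (j i) 𝔓))
    (fun i => Localization.localRingHom (Ideal.comap (j i) 𝔓) 𝔓 (j i) rfl)
    (fun i => inferInstance)
    (fun i => localRingHom_injective_of_frobenius (j i) q hq (hj i) (hfrob i) 𝔓)
    (fun i => localRingHom_isIntegral_of_frobenius (j i) q hq (hfrob i) 𝔓)
    (fun i => (hreg i).isRegularLocalRing_localization (Ideal.comap (j i) 𝔓)) (fun s => ?_)
  -- coverage of a finite subset by one stage: numerators and denominators
  have hsurj : ∀ y : Localization.AtPrime 𝔓, ∃ (x : C) (t : 𝔓.primeCompl),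
      IsLocalization.mk' (Localization.AtPrime 𝔓) x t = y := fun y => by
    obtain ⟨⟨x, t⟩, h⟩ := IsLocalization.mk'_surjective 𝔓.primeCompl y
    exact ⟨x, t, h⟩
  choose num den hnd using hsurj
  obtain ⟨i, hi⟩ := hcov (s.image num ∪ s.image fun y => (den y : C))
  refine ⟨i, fun y hy => ?_⟩
  obtain ⟨b', hb'⟩ := hi (Finset.mem_coe.mpr (Finset.mem_union_left _ (Finset.mem_image_of_mem num hy)))
  obtain ⟨t', ht'⟩ := hi (Finset.mem_coe.mpr
    (Finset.mem_union_right _ (Finset.mem_image_of_mem (fun y => (den y : C)) hy)))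
  have ht'' : j i t' ∉ 𝔓 := by rw [ht']; exact (den y).2
  have := mk'_mem_range_localRingHom (j i) 𝔓 b' t' ht''
  rw [← hnd y]
  convert this using 2
  · exact hb'.symm
  · exact Subtype.ext ht'.symm

end AbstractMain

section RingGlueMain

variable (k : Type) [Field k] {E : Type} [Field E] [Algebra k E] {G : Type} (θ : G → E)
  (A : Type) [CommRing A] [Algebra k A] (p : ℕ) [Fact p.Prime] [CharP k p] (r : ℕ)
  (hθ : ∀ i, ∃ y : k, algebraMap k E y = θ i ^ p ^ r)

/-- Every finite subset of `k(θ) ⊗ A` comes from one finite stage. [folklore] -/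
theorem exists_stage_subset_range (s : Finset (↥(IntermediateField.adjoin k (Set.range θ)) ⊗[k] A)) :
    ∃ S : Finset G, (s : Set (↥(IntermediateField.adjoin k (Set.range θ)) ⊗[k] A)) ⊆ Set.range ((Algebra.TensorProduct.map (IntermediateField.inclusion (stageField_le k θ S)) (AlgHom.id k A))) := by
  classical
  choose Sy hSy using fun z : ↥(IntermediateField.adjoin k (Set.range θ)) ⊗[k] A => exists_stage_mem_range k θ A z
  refine ⟨s.biUnion Sy, fun y hy => ?_⟩
  exact range_stageMap_mono k θ A (Finset.subset_biUnion_of_mem Sy hy) (hSy y)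

include hθ in
/-- **From the finite stages to the union.** If every `k(θ_S) ⊗ₖ A` (`S` finite) is a regular
ring, `k(θ) ⊗ₖ A` is Noetherian and the directed-union lemma holds, then `k(θ) ⊗ₖ A` is a regular
ring. [folklore] -/
theorem isRegularRing_tensor_unionField
    (hT5 : ∀ (O : Type) [CommRing O] [IsLocalRing O] [IsNoetherianRing O] (ι : Type) (Oi : ι → Type)
      [∀ i, CommRing (Oi i)] [∀ i, IsLocalRing (Oi i)] (φ : ∀ i, Oi i →+* O),
      (∀ i, IsLocalHom (φ i)) → (∀ i, Function.Injective (φ i)) → (∀ i, (φ i).IsIntegral) →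
      (∀ i, IsRegularLocalRing (Oi i)) →
      (∀ s : Finset O, ∃ i, (s : Set O) ⊆ Set.range (φ i)) →
      IsRegularLocalRing O)
    [IsNoetherianRing (↥(IntermediateField.adjoin k (Set.range θ)) ⊗[k] A)]
    (hS : ∀ S : Finset G, IsRegularRing (↥(IntermediateField.adjoin k (θ '' ((S : Finset G) : Set G))) ⊗[k] A)) :
    IsRegularRing (↥(IntermediateField.adjoin k (Set.range θ)) ⊗[k] A) :=
  stub_unionRegularOfStages hT5 (↥(IntermediateField.adjoin k (Set.range θ)) ⊗[k] A) (Finset G)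
    (fun S => ↥(IntermediateField.adjoin k (θ '' ((S : Finset G) : Set G))) ⊗[k] A) (fun S => ((Algebra.TensorProduct.map (IntermediateField.inclusion (stageField_le k θ S)) (AlgHom.id k A))).toRingHom) (p ^ r)
    (pow_pos (Fact.out : p.Prime).pos r) (fun S => stageMap_injective k θ A S)
    (fun S t => exists_stageMap_eq_pow k θ A p r hθ S t) hS
    (fun s => exists_stage_subset_range k θ A s)

end RingGlueMain




end Summit.ResolutionOfSingularities.ResolutionOfSingularities.Theorems

end
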